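import Mathlib
import Summits.ValiantsHypothesis.ValiantsHypothesis.Theorems.NewtonTauWeak.Negative.Zonogon
import Summits.ValiantsHypothesis.ValiantsHypothesis.Theorems.NewtonUnitEquationsNewtonTauWeakSeparatedRank
import Summits.ValiantsHypothesis.ValiantsHypothesis.Theorems.NewtonUnitEquationsNewtonTauWeakVdpDefs
import Summits.ValiantsHypothesis.ValiantsHypothesis.Theorems.NewtonUnitEquationsNewtonTauWeakStubVertexCharts
import Summits.ValiantsHypothesis.ValiantsHypothesis.Theorems.NewtonUnitEquationsNewtonTauWeakStubChartPairCount
import Summits.ValiantsHypothesis.ValiantsHypothesis.Theorems.NewtonUnitEquationsNewtonTauWeakStubProductVertices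
import Summits.ValiantsHypothesis.ValiantsHypothesis.Theorems.NewtonUnitEquationsNewtonTauWeakHexagonDelta
import Summits.ValiantsHypothesis.ValiantsHypothesis.Theorems.NewtonUnitEquationsNewtonTauWeakHexagonSeparated
import Summits.ValiantsHypothesis.ValiantsHypothesis.Theorems.NewtonUnitEquationsNewtonTauWeakHexagonWronskianStructure
import Summits.ValiantsHypothesis.ValiantsHypothesis.Theorems.NewtonUnitEquationsNewtonTauWeakHexagonVertexTools
import Summits.ValiantsHypothesis.ValiantsHypothesis.Theorems.NewtonUnitEquationsNewtonTauWeakHexagonPlanar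
import Summits.ValiantsHypothesis.ValiantsHypothesis.Theorems.NewtonUnitEquationsNewtonTauWeakHexagonTrichotomy
import Summits.ValiantsHypothesis.ValiantsHypothesis.Theorems.NewtonUnitEquationsNewtonTauWeakHexagonChartCount

/-!
# `NewtonUnitEquationsNewtonTauWeakHexagonCases` — Δ-Wronskian rung: main and degenerate cases

Rung toward `stub_binomialNewtonTauCommon` (T2 = KPTT Conj. 1 at `t = 2`; crux `NewtonTauWeak`,
stmt-ValiantsHypothesis-5904), line `binomial-normal-form`, lead c3: the GLOBAL Δ-WRONSKIAN argument for sums of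
three hexagon products `X(x)·Y(y)·D(xy)` (card `Cruxes/NewtonTauWeak/Lines/binomial-normal-form-delta-global.md`).

This file: the two CASES of the count for `f = g₀ + g₁ + g₂`, `gᵢ = Xᵢ·Yᵢ·Dᵢ`.
* `hex_main_case` (some minor of the column pair `(g₁, g₂)` is nonzero): Cramer's identity
  `M₀f - M₁Δf + M₂Δ²f = W` for the Wronskian matrix of `(g, Δg, Δ²g)` (`ring`), the structure
  `Mᵢ, W ∈ (diagonal) × Sep(4, 8, 16, 48)` (`hex_structure_*`) with `V ≤ 40, 72, 136, 392`
  (`hex_vert_diag_mul_le`), the trichotomy `hex_key_trichotomy` and the chart count `hex_chart_count`: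
  `V(f) ≤ 2·(2 + 4·248 + 392 + 496) = 3764`.
* `hex_degenerate_case` (all pairwise Wronskians `g_aΔg_b - g_bΔg_a` vanish): `hex_degenerate_line` confines the
  off-diagonal chart tops to the anti-diagonals of the `≤ 16` tops of one summand, or `Δf = 0` and `f` is
  diagonal: `V(f) ≤ 68`. [folklore]
-/

set_option linter.dupNamespace false

noncomputable section

namespace Summit.ValiantsHypothesis.ValiantsHypothesis.Theorems.NewtonUnitEquationsNewtonTauWeak

open scoped BigOperators
open MvPolynomial
open Literature.Computability.AlgebraicComplexity (newtonVertexCount)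
open Summit.ValiantsHypothesis.ValiantsHypothesis.Theorems.NewtonTauWeakVdp
open Summit.ValiantsHypothesis.ValiantsHypothesis.Theorems.NewtonTauWeak.Negative (vert)

namespace HexagonThree

/-! ## The main case: some Wronskian minor of the pair `(g₁, g₂)` is nonzero -/

/-- The quadratic attached to an exponent `z`: `P_z(T) = coeff z M₂·T² - coeff z M₁·T + coeff z M₀`. [folklore] -/
theorem quadratic_ne_zero {a b c : ℂ} (h : ¬ (c = 0 ∧ b = 0 ∧ a = 0)) :
    (Polynomial.C a * Polynomial.X ^ 2 + Polynomial.C (-b) * Polynomial.X + Polynomial.C c) ≠ 0 := by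
  intro hP
  apply h
  have h0 := congrArg (Polynomial.coeff · 0) hP
  have h1 := congrArg (Polynomial.coeff · 1) hP
  have h2 := congrArg (Polynomial.coeff · 2) hP
  simp only [Polynomial.coeff_add, Polynomial.coeff_C_mul, Polynomial.coeff_X_pow, Polynomial.coeff_X,
    Polynomial.coeff_C, Polynomial.coeff_zero] at h0 h1 h2
  norm_num at h0 h1 h2
  exact ⟨h0, by simpa using h1, h2⟩

end HexagonThree

open HexagonThree

/-- **Main case.** For three hexagon products `gᵢ = Xᵢ·Yᵢ·Dᵢ` such that NOT all of the minors
`M₀ = Δg₁Δ²g₂ - Δg₂Δ²g₁`, `M₁ = g₁Δ²g₂ - g₂Δ²g₁`, `M₂ = g₁Δg₂ - g₂Δg₁` vanish, the sum `g₀ + g₁ + g₂`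
has at most `3764` Newton vertices: Cramer's identity `M₀F - M₁ΔF + M₂Δ²F = W` (cofactor expansion of
the `3 × 3` Wronskian), the trichotomy (`hex_key_trichotomy`) and the chart count, with
`V(Mᵢ) ≤ 136, 72, 40` and `V(W) ≤ 392` from the (diagonal) × (separated) structure. [folklore] -/
theorem hex_main_case (Δ : MvPolynomial (Fin 2) ℂ → MvPolynomial (Fin 2) ℂ)
    (hΔ : ∀ p e, coeff e (Δ p) = (((e 0 : ℕ) : ℂ) - ((e 1 : ℕ) : ℂ)) * coeff e p)
    (hL : ∀ p q, Δ (p * q) = Δ p * q + p * Δ q)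
    (X₀ Y₀ D₀ X₁ Y₁ D₁ X₂ Y₂ D₂ : MvPolynomial (Fin 2) ℂ)
    (hX₀ : ∀ e ∈ X₀.support, e 1 = 0) (hY₀ : ∀ e ∈ Y₀.support, e 0 = 0) (hD₀ : ∀ e ∈ D₀.support, e 0 = e 1)
    (hX₁ : ∀ e ∈ X₁.support, e 1 = 0) (hY₁ : ∀ e ∈ Y₁.support, e 0 = 0) (hD₁ : ∀ e ∈ D₁.support, e 0 = e 1)
    (hX₂ : ∀ e ∈ X₂.support, e 1 = 0) (hY₂ : ∀ e ∈ Y₂.support, e 0 = 0) (hD₂ : ∀ e ∈ D₂.support, e 0 = e 1)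
    (hne : ¬ (Δ (X₁ * Y₁ * D₁) * Δ (Δ (X₂ * Y₂ * D₂)) - Δ (X₂ * Y₂ * D₂) * Δ (Δ (X₁ * Y₁ * D₁)) = 0 ∧
        (X₁ * Y₁ * D₁) * Δ (Δ (X₂ * Y₂ * D₂)) - (X₂ * Y₂ * D₂) * Δ (Δ (X₁ * Y₁ * D₁)) = 0 ∧
        (X₁ * Y₁ * D₁) * Δ (X₂ * Y₂ * D₂) - (X₂ * Y₂ * D₂) * Δ (X₁ * Y₁ * D₁) = 0)) :
    newtonVertexCount (X₀ * Y₀ * D₀ + X₁ * Y₁ * D₁ + X₂ * Y₂ * D₂) ≤ 3764 := by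
  classical
  set g₀ := X₀ * Y₀ * D₀ with hg₀
  set g₁ := X₁ * Y₁ * D₁ with hg₁
  set g₂ := X₂ * Y₂ * D₂ with hg₂
  set M₀ := Δ g₁ * Δ (Δ g₂) - Δ g₂ * Δ (Δ g₁) with hM₀
  set M₁ := g₁ * Δ (Δ g₂) - g₂ * Δ (Δ g₁) with hM₁
  set M₂ := g₁ * Δ g₂ - g₂ * Δ g₁ with hM₂
  set W := g₀ * M₀ - Δ g₀ * M₁ + Δ (Δ g₀) * M₂ with hW
  set F := g₀ + g₁ + g₂ with hF
  set S := M₀.support ∪ M₁.support ∪ M₂.support with hS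
  set U : MvPolynomial (Fin 2) ℂ := ∑ e ∈ S, monomial e (1 : ℂ) with hU
  have hUsupp : U.support = M₀.support ∪ M₁.support ∪ M₂.support := hex_support_sum_monomial_one S
  -- `U ≠ 0`
  have hU0 : U ≠ 0 := by
    intro h
    apply hne
    have hS0 : S = ∅ := by rw [hS, ← hUsupp, h, support_zero]
    have h0 : M₀.support = ∅ := Finset.subset_empty.mp (by
      rw [← hS0]; exact Finset.subset_union_left.trans Finset.subset_union_left)
    have h1 : M₁.support = ∅ := Finset.subset_empty.mp (by
      rw [← hS0]; exact Finset.subset_union_right.trans Finset.subset_union_left)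
    have h2 : M₂.support = ∅ := Finset.subset_empty.mp (by rw [← hS0]; exact Finset.subset_union_right)
    exact ⟨support_eq_empty.mp h0, support_eq_empty.mp h1, support_eq_empty.mp h2⟩
  -- Cramer's identity
  have hid : M₀ * F - M₁ * Δ F + M₂ * Δ (Δ F) = W := by
    have hDF : Δ F = Δ g₀ + Δ g₁ + Δ g₂ := by
      rw [hF, hex_delta_add Δ hΔ, hex_delta_add Δ hΔ]
    have hDDF : Δ (Δ F) = Δ (Δ g₀) + Δ (Δ g₁) + Δ (Δ g₂) := by
      rw [hDF, hex_delta_add Δ hΔ, hex_delta_add Δ hΔ]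
    rw [hDDF, hDF, hF, hW, hM₀, hM₁, hM₂]; ring
  -- vertex bounds of the fixed polynomials
  have hD₁₂ : ∀ e ∈ (D₁ * D₂).support, e 0 = e 1 := hex_diag_mul D₁ D₂ hD₁ hD₂
  have hV2 : newtonVertexCount M₂ ≤ 40 := by
    obtain ⟨m, hm, hEq⟩ := hex_structure_M2 Δ hΔ hL X₁ Y₁ D₁ X₂ Y₂ D₂ hX₁ hY₁ hD₁ hX₂ hY₂ hD₂
    have h := hex_vert_diag_mul_le (D₁ * D₂) m hD₁₂ hm
    rw [← hEq] at h
    exact h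
  have hV1 : newtonVertexCount M₁ ≤ 72 := by
    obtain ⟨m, hm, hEq⟩ := hex_structure_M1 Δ hΔ hL X₁ Y₁ D₁ X₂ Y₂ D₂ hX₁ hY₁ hD₁ hX₂ hY₂ hD₂
    have h := hex_vert_diag_mul_le (D₁ * D₂) m hD₁₂ hm
    rw [← hEq] at h
    exact h
  have hV0 : newtonVertexCount M₀ ≤ 136 := by
    obtain ⟨m, hm, hEq⟩ := hex_structure_M0 Δ hΔ hL X₁ Y₁ D₁ X₂ Y₂ D₂ hX₁ hY₁ hD₁ hX₂ hY₂ hD₂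
    have h := hex_vert_diag_mul_le (D₁ * D₂) m hD₁₂ hm
    rw [← hEq] at h
    exact h
  have hVW : newtonVertexCount W ≤ 392 := by
    obtain ⟨m, hm, hEq⟩ :=
      hex_structure_W3 Δ hΔ hL X₀ Y₀ D₀ X₁ Y₁ D₁ X₂ Y₂ D₂ hX₀ hY₀ hD₀ hX₁ hY₁ hD₁ hX₂ hY₂ hD₂
    have hD₀₁₂ : ∀ e ∈ (D₀ * D₁ * D₂).support, e 0 = e 1 :=
      hex_diag_mul _ _ (hex_diag_mul D₀ D₁ hD₀ hD₁) hD₂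
    have h := hex_vert_diag_mul_le (D₀ * D₁ * D₂) m hD₀₁₂ hm
    rw [← hEq] at h
    exact h
  have hVU : newtonVertexCount U ≤ 496 :=
    (hex_newtonVertexCount_union_le U M₀ M₁ M₂ hUsupp).trans (by omega)
  have hTU : ∀ σ : ℝ, {z : Fin 2 →₀ ℕ | ∃ t : ℝ, IsGeneric ![σ, t] ∧ IsTop ![σ, t] U z}.ncard ≤ 248 :=
    fun σ => (hex_ncard_chartTops_union_le σ U M₀ M₁ M₂ hUsupp).trans (by omega)
  -- the quadratic and the trichotomy
  set Pz : (Fin 2 →₀ ℕ) → Polynomial ℂ := fun z =>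
    Polynomial.C (coeff z M₂) * Polynomial.X ^ 2 + Polynomial.C (-(coeff z M₁)) * Polynomial.X +
      Polynomial.C (coeff z M₀) with hPz
  have hPz' : ∀ z ∈ U.support, Pz z ≠ 0 ∧ (Pz z).natDegree ≤ 2 := by
    intro z hz
    refine ⟨quadratic_ne_zero fun h => ?_, Polynomial.natDegree_quadratic_le⟩
    rw [hUsupp, Finset.mem_union, Finset.mem_union, mem_support_iff, mem_support_iff,
      mem_support_iff] at hz
    tauto
  have htri : ∀ σ : ℝ, ∀ t : ℝ, IsGeneric ![σ, t] → ∀ v z : Fin 2 →₀ ℕ, IsTop ![σ, t] F v → v 0 ≠ v 1 →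
      IsTop ![σ, t] U z →
        (Pz z).IsRoot ((((v 0 : ℕ) : ℂ)) - ((v 1 : ℕ) : ℂ)) ∨ IsTop ![σ, t] W (z + v) := by
    intro σ t ht v z hv hvv hz
    rcases hex_key_trichotomy Δ hΔ M₀ M₁ M₂ F W U hid hUsupp ht hv hvv hz with h | h
    · left
      rw [Polynomial.IsRoot.def]
      simp only [hPz, Polynomial.eval_add, Polynomial.eval_mul, Polynomial.eval_C, Polynomial.eval_pow,
        Polynomial.eval_X]
      linear_combination h
    · exact Or.inr h.2
  -- the two charts
  have hchart : ∀ σ : ℝ, (σ = 1 ∨ σ = -1) →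
      {v : Fin 2 →₀ ℕ | ∃ t : ℝ, IsGeneric ![σ, t] ∧ IsTop ![σ, t] F v}.ncard ≤ 1882 := by
    intro σ hσ
    have h := hex_chart_count σ hσ F U W Pz hPz' (htri σ) hU0
    have h2 := hTU σ
    omega
  have hv := stub_vertexCharts F
  have h1 := hchart 1 (Or.inl rfl)
  have h2 := hchart (-1) (Or.inr rfl)
  omega

namespace HexagonThree

/-! ## The degenerate case: all pairwise Wronskians vanish -/

/-- A hexagon product `X·Y·D` has at most `16` Newton vertices (it is `D × (X·Y)`, separated of rank 1;
in truth a hexagon). [folklore] -/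
theorem newtonVertexCount_hexProd_le (X Y D : MvPolynomial (Fin 2) ℂ)
    (hX : ∀ e ∈ X.support, e 1 = 0) (hY : ∀ e ∈ Y.support, e 0 = 0) (hD : ∀ e ∈ D.support, e 0 = e 1) :
    newtonVertexCount (X * Y * D) ≤ 16 := by
  have hsep : ∃ P Q : Fin 1 → MvPolynomial (Fin 2) ℂ, (∀ r, ∀ e ∈ (P r).support, e 1 = 0) ∧
      (∀ r, ∀ e ∈ (Q r).support, e 0 = 0) ∧ X * Y = ∑ r, P r * Q r :=
    ⟨fun _ => X, fun _ => Y, fun _ => hX, fun _ => hY, by simp⟩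
  have h := hex_vert_diag_mul_le D (X * Y) hD hsep
  have hEq : X * Y * D = D * (X * Y) := by ring
  rw [hEq]
  exact h

end HexagonThree

/-- **Degenerate case.** If all pairwise `2 × 2` Wronskians `g_a Δg_b - g_b Δg_a` of three hexagon
products vanish, their sum has at most `68` Newton vertices: either every `Δg_a = 0`, so `ΔF = 0` and
`F` is supported on the diagonal (`≤ 4` vertices), or `hex_degenerate_line` puts every off-diagonal chart
top of `F` on the anti-diagonal of one of the `≤ 16` tops of some `g_a` (two per line), plus `≤ 2` on the
diagonal, per chart. [folklore] -/
theorem hex_degenerate_case (Δ : MvPolynomial (Fin 2) ℂ → MvPolynomial (Fin 2) ℂ)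
    (hΔ : ∀ p e, coeff e (Δ p) = (((e 0 : ℕ) : ℂ) - ((e 1 : ℕ) : ℂ)) * coeff e p)
    (X Y D : Fin 3 → MvPolynomial (Fin 2) ℂ)
    (hX : ∀ l, ∀ e ∈ (X l).support, e 1 = 0) (hY : ∀ l, ∀ e ∈ (Y l).support, e 0 = 0)
    (hD : ∀ l, ∀ e ∈ (D l).support, e 0 = e 1)
    (hW : ∀ a b, (X a * Y a * D a) * Δ (X b * Y b * D b) = (X b * Y b * D b) * Δ (X a * Y a * D a)) :
    newtonVertexCount (∑ l, X l * Y l * D l) ≤ 68 := by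
  classical
  set g : Fin 3 → MvPolynomial (Fin 2) ℂ := fun l => X l * Y l * D l with hg
  have hsum : (∑ l, X l * Y l * D l) = ∑ l, g l := rfl
  rw [hsum]
  set F := ∑ l, g l with hF
  by_cases hall : ∀ a, Δ (g a) = 0
  · -- `ΔF = 0`: `F` is diagonal
    have hDF : Δ F = 0 := by
      rw [hF, HexagonTrichotomy.delta_sum' Δ hΔ]
      exact Finset.sum_eq_zero fun a _ => hall a
    have hdiag : ∀ e ∈ F.support, e 0 = e 1 := by
      intro e he
      have h := congrArg (coeff e) hDF
      rw [hΔ, coeff_zero] at h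
      rcases mul_eq_zero.mp h with h | h
      · exact_mod_cast sub_eq_zero.mp h
      · exact absurd h (mem_support_iff.mp he)
    exact (hex_newtonVertexCount_le_four_of_diag F hdiag).trans (by norm_num)
  · push Not at hall
    obtain ⟨a, ha⟩ := hall
    have hW' : ∀ a b, g a * Δ (g b) = g b * Δ (g a) := fun a b => hW a b
    -- the anti-diagonals of the tops of `g a`
    set Tg := {z : Fin 2 →₀ ℕ | ∃ w : Fin 2 → ℝ, IsTop w (g a) z} with hTg
    have hTgfin : Tg.Finite := ChartPairCount.tops_finite (g a)
    have hTgle : Tg.ncard ≤ 16 :=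
      (ChartPairCount.ncard_tops_le (g a)).trans (newtonVertexCount_hexProd_le _ _ _ (hX a) (hY a) (hD a))
    set Dg := {v : Fin 2 →₀ ℕ | (∃ w : Fin 2 → ℝ, IsTop w F v) ∧ ((v 0 : ℕ) : ℤ) - ((v 1 : ℕ) : ℤ) = 0}
      with hDg
    set L : (Fin 2 →₀ ℕ) → Set (Fin 2 →₀ ℕ) := fun z =>
      {v | (∃ w : Fin 2 → ℝ, IsTop w F v) ∧
        ((v 0 : ℕ) : ℤ) - ((v 1 : ℕ) : ℤ) = ((z 0 : ℕ) : ℤ) - ((z 1 : ℕ) : ℤ)} with hL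
    have hFfin : {v : Fin 2 →₀ ℕ | ∃ w : Fin 2 → ℝ, IsTop w F v}.Finite := ChartPairCount.tops_finite F
    have hchart : ∀ σ : ℝ,
        {v : Fin 2 →₀ ℕ | ∃ t : ℝ, IsGeneric ![σ, t] ∧ IsTop ![σ, t] F v}.ncard ≤ 34 := by
      intro σ
      have hcover : {v : Fin 2 →₀ ℕ | ∃ t : ℝ, IsGeneric ![σ, t] ∧ IsTop ![σ, t] F v} ⊆
          Dg ∪ ⋃ z ∈ hTgfin.toFinset, L z := by
        rintro v ⟨t, ht, hv⟩
        by_cases hvv : v 0 = v 1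
        · refine Or.inl ⟨⟨_, hv⟩, ?_⟩
          rw [hvv]; exact sub_self _
        · obtain ⟨z, hz, hzv⟩ := hex_degenerate_line Δ hΔ g hW' a ha ht hv hvv
          refine Or.inr (Set.mem_iUnion₂.mpr ⟨z, (Set.Finite.mem_toFinset hTgfin).mpr ⟨_, hz⟩, ?_⟩)
          exact ⟨⟨_, hv⟩, hzv.symm⟩
      have hUfin : (⋃ z ∈ hTgfin.toFinset, L z).Finite :=
        Set.Finite.biUnion (Finset.finite_toSet _) fun z _ => hFfin.subset fun v hv => hv.1
      have hDgfin : Dg.Finite := hFfin.subset fun v hv => hv.1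
      calc {v : Fin 2 →₀ ℕ | ∃ t : ℝ, IsGeneric ![σ, t] ∧ IsTop ![σ, t] F v}.ncard
          ≤ (Dg ∪ ⋃ z ∈ hTgfin.toFinset, L z).ncard := Set.ncard_le_ncard hcover (hDgfin.union hUfin)
        _ ≤ Dg.ncard + (⋃ z ∈ hTgfin.toFinset, L z).ncard := Set.ncard_union_le _ _
        _ ≤ 2 + ∑ z ∈ hTgfin.toFinset, (L z).ncard :=
            add_le_add (hex_ncard_tops_sub_eq_le_two F 0) (Finset.set_ncard_biUnion_le _ _)
        _ ≤ 2 + ∑ _z ∈ hTgfin.toFinset, 2 := by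
            gcongr with z
            exact hex_ncard_tops_sub_eq_le_two F _
        _ = 2 + 2 * Tg.ncard := by
            rw [Finset.sum_const, smul_eq_mul, mul_comm, Set.ncard_eq_toFinset_card Tg hTgfin]
        _ ≤ 34 := by omega
    have hv := stub_vertexCharts F
    have h1 := hchart 1
    have h2 := hchart (-1)
    omega

end Summit.ValiantsHypothesis.ValiantsHypothesis.Theorems.NewtonUnitEquationsNewtonTauWeak

end
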